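import Literature.NumberTheory.IwasawaTheory.ZpExtensionLayerSuccRamifiedPrimesLe
import Literature.NumberTheory.IwasawaTheory.CyclotomicTwoTotallyRamifiedOddIndex
import Literature.NumberTheory.IwasawaTheory.ClassicalMuVanishesUnitNormIndexTrivialBase
import Literature.NumberTheory.IwasawaTheory.CyclotomicTwoLayerTwoDyadicPrimeCertificate
import Literature.NumberTheory.NumberFields.DyadicUnitSquaresRamifiedPrimeFour
import HarnessLib

/-!
# The LAYER-TWO unit door with a BASE-FIELD certificate (`p = 2`): `e_m = e_2` for all `m ≥ 2`, `μ₂ = 0`, `λ₂ = 0` for an odd-degree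
# field `K` with `2 ∤ h_K` and at most two primes above `2`, from ONE unit `η = A + Bθ + Cθ² + Dθ³` of `K₂ = K(θ)`, `θ⁴ − 4θ² + 2 = 0`,
# whose non-norm property from `K₃ = K₂(√(2+θ))` is certified by identities and ideal memberships in `𝓞_K` alone

Topic `NumberTheory/IwasawaTheory` (namespace = path).  THEOREMS ONLY (no definition, no named fact, no instance, no `sorry`); unconditional.
Written by the prover seat `bsd-line-att-p3` g44 (cell `bsd-f1-sign2`, WIDTH-5 attach on route `AlignedTransportAtTwo`, crux C2
stmt-BirchSwinnertonDyer-22298; `--supports`, closes nothing).  The rung-`2` sequel of `ClassicalMuVanishesLayerOneUnitCertificateTwo.lean`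
(att-p3 g41: the same door at the layer `K₁ = K(√2)`, certificate `v − 1 ∈ P⁴ ∖ P⁵` at `e = 2`).

## What and why

Over a base with `2 ∤ h_K` in which every ramified prime of the cyclotomic `ℤ₂`-extension is totally ramified (Fukuda index `0`), ONE unit of the
layer `K_n` that is not a norm from `K_{n+1}` forces `e_{n+1} = e_n` (Chevalley's unit norm index; tree
`ClassicalMuVanishesUnitNormIndexTrivialBase.classNumberPExp_eq_of_le_two_of_nonNorm_unit_of_not_dvd`, att-p3 g39, any `n`), hence `e_m = e_n` for all
`m ≥ n` (Fukuda) and `μ = λ = 0`.  Genus theory (Chevalley's ambiguous class number formula along the tower: `#A_n^{Gal} = 2^{min(n, t−2)}` when the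
fundamental unit satisfies `σ₁(ε) ≡ ±1 (mod 2^t)` exactly at a split dyadic prime) shows that the first layer where such a unit CAN exist is
`n = t − 2`: the layer-ONE door (g41) serves the class `σ₁(ε) ≡ ±7 (mod 16)`; THIS file is the door at `n = 2`, serving `σ₁(ε) ≡ ±15 (mod 32)`,
where Chevalley's door, the layer-one unit door and the depth door (`e₁ ≤ 1`) are all void.  As at `n = 1`, no consumer can name a prime, an
element or a unit of the abstract layers `κ.layer 2 ⊂ κ.layer 3`; this file composes the pieces and pushes EVERY hypothesis down to `𝓞_K`:

* §1 (layers): `finrank_layer_two_layer_three` (`[K₃ : K₂] = 2`) and ★ `exists_quartic_root_layer_two_sqrt_add_layer_three` — `K₂ ∋ θ` with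
  `θ⁴ − 4θ² + 2 = 0` and `K₃ ∋ t` with `t² = 2 + θ`, `t ∉ K₂`: the tree's layer models (`exists_iterate_root_layer_of_not_dvd_finrank`: `K_n ∋` a root
  of `Ψ_n`, `Ψ₂ = (X²−2)² − 2`, `Ψ₃ = Ψ₂² − 2`) give `θ₀ ∈ K₂` and `ψ ∈ K₃`; `θ' = ψ² − 2` satisfies `(θ'² − 2)² = 2 = (θ₀² − 2)²`, so
  `θ'² ∈ {θ₀², 4 − θ₀² = (θ₀³ − 3θ₀)²}` and `θ' ∈ {±θ₀, ±(θ₀³ − 3θ₀)}` — the root `θ` is CHOSEN among the four roots of `X⁴ − 4X² + 2` in `K₂` so that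
  `ψ² = 2 + θ`; `ψ ∉ K₂` as `[K(ψ) : K] = 8 > 4` (tree `NestedSqrtTwo.finrank_adjoin_eq_of_odd_finrank`).
* §2 ★★ `classNumberPExp_eq_of_le_of_layerTwo_unitCert` / `classicalMuVanishes_two_of_layerTwo_unitCert` — `K` of odd degree, `κ` cyclotomic with
  Fukuda index `0`, `2 ∤ h_K`, at most two primes of `K` above `2`, `𝔭₁` of norm `2` with `2 ∉ 𝔭₁²`, and `A, B, C, D, A', B', C', D', π₁, d, γ₀, γ₁, γ₂, γ₃ ∈ 𝓞_K`
  with the four coefficient identities of `(A + Bθ + Cθ² + Dθ³)(A' + B'θ + C'θ² + D'θ³) = 1` modulo `θ⁴ = 4θ² − 2` (so `η = A + Bθ + Cθ² + Dθ³` is a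
  unit of `𝓞_{K₂}` for EVERY root `θ`) and the certificate `π₁ ∈ 𝔭₁ ∖ 𝔭₁²`, `d, γ₀ ∉ 𝔭₁`, `d(A − 1) = π₁²γ₀`, `dB = π₁²γ₁`, `dC = π₁²γ₂`, `dD = π₁²γ₃`
  (companion `CyclotomicTwoLayerTwoDyadicPrimeCertificate.sub_one_mem_pow_eight_of_baseCert`: `η − 1 ∈ P⁸ ∖ P⁹` at the prime `P ∣ 𝔭₁` of `K₂`,
  `e = 4`, `f = 1`, `2 + θ ∈ P ∖ P²`) ⟹ `η ∉ N(K₃ˣ)` (`NumberFields/DyadicUnitSquaresRamifiedPrimeFour`, O'Meara 63:10 at `e = 4`) ⟹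
  **`e_m = e_2` for all `m ≥ 2`, `μ₂ = 0`, `λ₂ = 0`**; `…_of_not_dvd_discr` forms for `2 ∤ d_K`.  The certificate is insensitive to the choice of the
  root `θ` (all four roots give Galois-conjugate units `σ(η)` with the same congruences), which is why §1's CHOICE of `θ` is harmless.

USE (cell bsd-f1-sign2, crux C2, W-free; nothing about any curve is asserted here): `K = ℚ(β)` the cubic `2`-torsion field of a seed with
`Δ_W ≡ 5 (mod 8)` and `h(K)` odd whose fundamental unit has `σ₁(ε) ≡ ±15 (mod 32)` (so `#Cl(K_n)^{Gal}[2^∞] = 4` for all `n ≥ 2`, Chevalley's door and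
the layer-one unit door are void, and `e₂ ≥ e₁ + 1 ≥ 3`): THIS door fires iff `e₃ = e₂`, iff `[E_{K₂} : E_{K₂} ∩ N K₃ˣ] = 2`, iff
`ε ∈ ±N_{K₂/K}(E_{K₂})`, iff the class of the prime of `K₂` above `𝔭₂` has order `4`, iff the prime of `K₁` above `𝔭₂` does NOT capitulate in `K₂`
(memo `LAYER-TWO-UNIT-DOOR-att-p3-g44.md`); its only input beyond `h(K)` odd is ONE unit `A + Bθ + Cθ² + Dθ³` of the degree-`4[K:ℚ]` field `K(θ)` with
`A ≡ 1`, `B ≡ C ≡ D ≡ 0 (mod 𝔭₁²)` (up to a `𝔭₁`-unit `d`) and `(A − 1)/π₁² ∉ 𝔭₁` — a finite search (PARI `bnfinit`), verified by `linear_combination` in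
`ℤ[β]` and ideal membership at `𝔭₁`.  Such a representative exists whenever a non-norm unit exists (`(1 + π⁸δ)·U⁹·N = U` locally).

HONEST SCOPE: classical genus theory + Fukuda (1994) + O'Meara's dyadic local square theorem, all in the tree as separate files; this file is the
composition and the base-field bookkeeping at the second layer.  No certificate for any particular field is asserted.  BSD is not advanced by this file.

## References

* T. Fukuda, *Remarks on `ℤ_p`-extensions of number fields*, Proc. Japan Acad. 70 A (1994), Thm. 1 (1), p. 264. [Fukuda1994]
* S. Lang, *Cyclotomic Fields I and II*, GTM 121 (1990), Ch. 13 §4, Lemma 4.1–4.2 and sequel (PDF pp. 203–204). [Lang1990]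
* L. C. Washington, *Introduction to Cyclotomic Fields*, 2nd ed., GTM 83 (1997), §13.1 (`ℚ_2 = ℚ(ζ₁₆)⁺`, `ℚ_3 = ℚ(ζ₃₂)⁺`, `K_n = K·ℚ_n`),
  Prop. 13.2, Lemma 13.3, §13.3 Lemma 13.15 and Prop. 13.22. [Washington1997]
* O. T. O'Meara, *Introduction to Quadratic Forms* (1963), §63A (63:1, 63:5), §63B (63:10, 63:11a). [Omeara1963]
* R. Greenberg, *On the Iwasawa invariants of totally real number fields*, Amer. J. Math. 98 (1976), 263–284, §§3–4 (finiteness of `X` read off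
  ambiguous classes / units that are norms — the shape of the «fires iff» statement above). [Greenberg1976]
* J. Neukirch, *Algebraic Number Theory* (1999), Ch. I §8 Prop. (8.2), Ch. III (2.12). [NeukirchANT1999]
-/

noncomputable section

open NumberField IsDedekindDomain Field
open scoped nonZeroDivisors IntermediateField

namespace Literature.NumberTheory.IwasawaTheory

open Literature.NumberTheory.EllipticCurves Literature.NumberTheory.NumberFields
  Literature.NumberTheory.NumberFields.AmbiguousClass
  Literature.NumberTheory.GaloisRepresentations Literature.NumberTheory.GaloisRepresentations.Herbrand
  Literature.NumberTheory.GaloisRepresentations.MinkowskiUnit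
  Literature.NumberTheory.GaloisRepresentations.CyclicNormIndex

/-! ## §1 The layers `K₂ = K(θ) ⊂ K₃ = K₂(√(2+θ))` of a cyclotomic `ℤ₂`-extension of an odd-degree field -/

section Layers

variable {K : Type} [Field K] [NumberField K] (κ : ZpExtension K 2)
  [Algebra (κ.layer 2) (κ.layer (2 + 1))] [IsScalarTower K (κ.layer 2) (κ.layer (2 + 1))]

/-- `[K₃ : K₂] = 2` for a `ℤ₂`-extension (tower law: `[K_n : K] = 2ⁿ`). [cite: Washington1997, §13.1 (`[K_n : K] = pⁿ`)] -/
theorem finrank_layer_two_layer_three : Module.finrank (κ.layer 2) (κ.layer (2 + 1)) = 2 := by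
  haveI : FiniteDimensional K (κ.layer 2) := κ.finiteDimensional_layer_holds 2
  haveI : FiniteDimensional K (κ.layer (2 + 1)) := κ.finiteDimensional_layer_holds (2 + 1)
  haveI : Module.Free (κ.layer 2) (κ.layer (2 + 1)) := Module.Free.of_divisionRing _ _
  have h := Module.finrank_mul_finrank K (κ.layer 2) (κ.layer (2 + 1))
  rw [κ.finrank_layer_holds 2, κ.finrank_layer_holds (2 + 1), pow_succ] at h
  exact Nat.eq_of_mul_eq_mul_left (pow_pos Nat.prime_two.pos 2) h

omit [IsScalarTower K (κ.layer 2) (κ.layer (2 + 1))] in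
/-- ★ **`K₂ ∋ θ` with `θ⁴ − 4θ² + 2 = 0` and `K₃ ∋ t` with `t² = 2 + θ`, `t ∉ K₂`** (`2 ∤ [K:ℚ]`, `κ` cyclotomic).  `K₃ = K·ℚ(ζ₃₂)⁺` contains a root
`ψ` of `Ψ₃ = ((X² − 2)² − 2)² − 2` and `K₂` a root `θ₀` of `Ψ₂ = X⁴ − 4X² + 2` (tree `exists_iterate_root_layer_of_not_dvd_finrank`); `θ' = ψ² − 2`
has `(θ'² − 2)² = 2 = (θ₀² − 2)²`, so `θ'² = θ₀²` or `θ'² = 4 − θ₀² = (θ₀³ − 3θ₀)²`, i.e. `θ' ∈ {±θ₀, ±(θ₀³ − 3θ₀)}` — all four are roots of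
`X⁴ − 4X² + 2` in `K₂`, and for the right one `ψ² = 2 + θ`.  And `ψ ∉ K₂`: the minimal polynomial of `ψ` over the odd-degree field `K` has degree
`8 > [K₂ : K] = 4` (tree `NestedSqrtTwo.finrank_adjoin_eq_of_odd_finrank`). [cite: Washington1997, §13.1 (`ℚ_2 = ℚ(ζ₁₆)⁺`, `ℚ_3 = ℚ(ζ₃₂)⁺`, `K_n = K·ℚ_n`)] -/
theorem exists_quartic_root_layer_two_sqrt_add_layer_three (hK2 : ¬ 2 ∣ Module.finrank ℚ K) (hκ : κ.IsCyclotomic) :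
    ∃ θ : κ.layer 2, θ ^ 4 - 4 * θ ^ 2 + 2 = 0 ∧ ∃ t : κ.layer (2 + 1),
      t ^ 2 = algebraMap (κ.layer 2) (κ.layer (2 + 1)) (2 + θ) ∧
        t ∉ Set.range (algebraMap (κ.layer 2) (κ.layer (2 + 1))) := by
  haveI : Fact (Nat.Prime 2) := ⟨Nat.prime_two⟩
  haveI : FiniteDimensional K (κ.layer 2) := κ.finiteDimensional_layer_holds 2
  have hodd : Odd (Module.finrank ℚ K) := Nat.not_even_iff_odd.mp fun h => hK2 (even_iff_two_dvd.mp h)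
  obtain ⟨θ₀, hθ₀⟩ := exists_iterate_root_layer_of_not_dvd_finrank hK2 κ hκ 2
  rw [iterate_sq_sub_two_two] at hθ₀
  have hq₀ : θ₀ ^ 4 - 4 * θ₀ ^ 2 + 2 = 0 := by linear_combination hθ₀
  obtain ⟨ψ, hψ⟩ := exists_iterate_root_layer_of_not_dvd_finrank hK2 κ hκ (2 + 1)
  -- `ψ ∉ K₂`
  have hψK : ψ ∉ Set.range (algebraMap (κ.layer 2) (κ.layer (2 + 1))) := by
    rintro ⟨a, ha⟩
    have ha3 : (fun x : κ.layer 2 => x ^ 2 - 2)^[2 + 1] a = 0 := by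
      apply (algebraMap (κ.layer 2) (κ.layer (2 + 1))).injective
      have h := NestedSqrtTwo.map_iterate (algebraMap (κ.layer 2) (κ.layer (2 + 1))) a (2 + 1)
      rw [h, ha, hψ, map_zero]
    have h8 := NestedSqrtTwo.finrank_adjoin_eq_of_odd_finrank hodd a ha3
    have htower := Module.finrank_mul_finrank K (IntermediateField.adjoin K ({a} : Set (κ.layer 2))) (κ.layer 2)
    rw [h8, κ.finrank_layer_holds 2] at htower
    omega
  -- `θ' = ψ² − 2` has `(θ'² − 2)² = 2`
  have hψ' : (((ψ ^ 2 - 2) ^ 2 - 2) ^ 2 - 2 : κ.layer (2 + 1)) = 0 := by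
    rw [Function.iterate_succ_apply', iterate_sq_sub_two_two] at hψ
    exact hψ
  set ι := algebraMap (κ.layer 2) (κ.layer (2 + 1)) with hι
  have hq₀' : ι θ₀ ^ 4 - 4 * ι θ₀ ^ 2 + 2 = 0 := by
    have h := congrArg ι hq₀
    simp only [map_add, map_sub, map_mul, map_pow, map_ofNat, map_zero] at h
    exact h
  -- `(θ'² − 2)² = (θ₀² − 2)²`
  have hsq : ((ψ ^ 2 - 2) ^ 2 - 2) ^ 2 = (ι θ₀ ^ 2 - 2) ^ 2 := by linear_combination hψ' - hq₀'
  -- the four roots of `X⁴ − 4X² + 2` in `K₂` are `±θ₀`, `±(θ₀³ − 3θ₀)`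
  have hroot : ∀ θ : κ.layer 2, (θ = θ₀ ∨ θ = -θ₀ ∨ θ = θ₀ ^ 3 - 3 * θ₀ ∨ θ = -(θ₀ ^ 3 - 3 * θ₀)) →
      θ ^ 4 - 4 * θ ^ 2 + 2 = 0 := by
    rintro θ (rfl | rfl | rfl | rfl)
    · exact hq₀
    · linear_combination hq₀
    · linear_combination (θ₀ ^ 8 - 8 * θ₀ ^ 6 + 20 * θ₀ ^ 4 - 16 * θ₀ ^ 2 + 1) * hq₀
    · linear_combination (θ₀ ^ 8 - 8 * θ₀ ^ 6 + 20 * θ₀ ^ 4 - 16 * θ₀ ^ 2 + 1) * hq₀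
  rcases eq_or_eq_neg_of_sq_eq_sq _ _ hsq with h | h
  · -- `θ'² = θ₀²`
    have hsq' : (ψ ^ 2 - 2) ^ 2 = (ι θ₀) ^ 2 := by linear_combination h
    rcases eq_or_eq_neg_of_sq_eq_sq _ _ hsq' with h' | h'
    · refine ⟨θ₀, hq₀, ψ, ?_, hψK⟩
      simp only [map_add, map_ofNat]
      linear_combination h'
    · refine ⟨-θ₀, hroot _ (Or.inr (Or.inl rfl)), ψ, ?_, hψK⟩
      simp only [map_add, map_ofNat, map_neg]
      linear_combination h'
  · -- `θ'² = 4 − θ₀² = (θ₀³ − 3θ₀)²`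
    have hsq' : (ψ ^ 2 - 2) ^ 2 = (ι (θ₀ ^ 3 - 3 * θ₀)) ^ 2 := by
      simp only [map_sub, map_mul, map_pow, map_ofNat]
      linear_combination h + (2 - ι θ₀ ^ 2) * hq₀'
    rcases eq_or_eq_neg_of_sq_eq_sq _ _ hsq' with h' | h'
    · refine ⟨θ₀ ^ 3 - 3 * θ₀, hroot _ (Or.inr (Or.inr (Or.inl rfl))), ψ, ?_, hψK⟩
      simp only [map_add, map_sub, map_mul, map_pow, map_ofNat] at h' ⊢
      linear_combination h'
    · refine ⟨-(θ₀ ^ 3 - 3 * θ₀), hroot _ (Or.inr (Or.inr (Or.inr rfl))), ψ, ?_, hψK⟩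
      simp only [map_add, map_sub, map_mul, map_pow, map_neg, map_ofNat] at h' ⊢
      linear_combination h'

end Layers

/-! ## §2 The door: `e_m = e_2` for all `m ≥ 2`, `μ₂ = 0`, `λ₂ = 0` from `2 ∤ h_K`, at most two primes above `2`, and ONE unit of `K₂` certified in `𝓞_K` -/

section Door

variable {K : Type} [Field K] [NumberField K] (κ : ZpExtension K 2)

/-- ★★ **THE LAYER-TWO UNIT DOOR WITH A BASE-FIELD CERTIFICATE: `e_m = e_2` for all `m ≥ 2`.**  `K` a number field of odd degree with
`2 ∤ h_K` and at most two primes above `2`; `κ` a cyclotomic `ℤ₂`-extension of `K` with Fukuda's index `0` (`TotallyRamifiedFrom κ 0`, e.g.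
`2 ∤ d_K`); `𝔭₁` a prime of `𝓞_K` of norm `2` with `2 ∉ 𝔭₁²` (a degree-one unramified dyadic prime).  DATA IN `𝓞_K`: `A, B, C, D, A', B', C', D'` with
the four coefficient identities of `(A + Bθ + Cθ² + Dθ³)(A' + B'θ + C'θ² + D'θ³) = 1` reduced modulo `θ⁴ = 4θ² − 2` (`θ⁵ = 4θ³ − 2θ`,
`θ⁶ = 14θ² − 8`) — so `η = A + Bθ + Cθ² + Dθ³` is a unit of `K₂ = K(θ)` with inverse `A' + B'θ + C'θ² + D'θ³`, for EVERY root `θ` of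
`X⁴ − 4X² + 2` — and `π₁ ∈ 𝔭₁ ∖ 𝔭₁²`, `d ∉ 𝔭₁`, `γ₀ ∉ 𝔭₁`, `γ₁, γ₂, γ₃` with `d(A − 1) = π₁²γ₀`, `dB = π₁²γ₁`, `dC = π₁²γ₂`, `dD = π₁²γ₃`.  THEN the
`2`-class numbers of the layers are constant from `K₂` on.  Proof: the prime `P ∣ 𝔭₁` of `K₂` has `e = 4`, `f = 1`, `2 + θ ∈ P ∖ P²`,
`K₃ = K₂(√(2+θ))` (§1), and `η − 1 ∈ P⁸ ∖ P⁹`, so `η ∉ N(K₃ˣ)` (tree `unitsIncl_unitsMap_not_mem_map_norm_of_sub_one_mem_pow_eight`, O'Meara 63:10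
at `e = 4`); at most two primes of `K₂` ramify in `K₃` (tree `ncard_ramified_layer_succ_le`); the one-unit door over a base with `2 ∤ h_K` at the layer
`n = 2` (tree `classNumberPExp_eq_of_le_two_of_nonNorm_unit_of_not_dvd`) concludes. [cite: Fukuda1994, Thm. 1 (1), p. 264]
[cite: Lang1990, Ch. 13 §4, Lemma 4.1–4.2 and sequel (PDF pp. 203–204)] [cite: Omeara1963, §63B (63:10)] [cite: Washington1997, §13.3 Prop. 13.22] -/
theorem classNumberPExp_eq_of_le_of_layerTwo_unitCert (hκ : κ.IsCyclotomic) (hK2 : ¬ 2 ∣ Module.finrank ℚ K)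
    (hram : TotallyRamifiedFrom κ 0) (hK : ¬ 2 ∣ classNumber K)
    (h2 : {v : HeightOneSpectrum (𝓞 K) | ((2 : ℕ) : 𝓞 K) ∈ v.asIdeal}.ncard ≤ 2)
    (𝔭₁ : Ideal (𝓞 K)) (hN : Ideal.absNorm 𝔭₁ = 2) (hunr : (2 : 𝓞 K) ∉ 𝔭₁ ^ 2)
    {A B C D A' B' C' D' π₁ d γ₀ γ₁ γ₂ γ₃ : 𝓞 K}
    (h0 : A * A' - 2 * (B * D' + C * C' + D * B') - 8 * (D * D') = 1)
    (h1 : A * B' + B * A' - 2 * (C * D' + D * C') = 0)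
    (h2c : A * C' + B * B' + C * A' + 4 * (B * D' + C * C' + D * B') + 14 * (D * D') = 0)
    (h3 : A * D' + B * C' + C * B' + D * A' + 4 * (C * D' + D * C') = 0)
    (hπ₁ : π₁ ∈ 𝔭₁) (hπ₁' : π₁ ∉ 𝔭₁ ^ 2) (hd : d ∉ 𝔭₁) (hγ₀ : γ₀ ∉ 𝔭₁)
    (hA : d * (A - 1) = π₁ ^ 2 * γ₀) (hB : d * B = π₁ ^ 2 * γ₁) (hC : d * C = π₁ ^ 2 * γ₂) (hD : d * D = π₁ ^ 2 * γ₃)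
    {m : ℕ} (hm : 2 ≤ m) :
    classNumberPExp κ m = classNumberPExp κ 2 := by
  classical
  haveI : Fact (Nat.Prime 2) := ⟨Nat.prime_two⟩
  -- the layers `K₂ ⊂ K₃`
  have h23 : κ.layer 2 ≤ κ.layer (2 + 1) := κ.layer_mono (by omega)
  letI : Algebra (κ.layer 2) (κ.layer (2 + 1)) := (IntermediateField.inclusion h23).toRingHom.toAlgebra
  haveI : IsScalarTower K (κ.layer 2) (κ.layer (2 + 1)) :=
    IsScalarTower.of_algebraMap_eq fun x => ((IntermediateField.inclusion h23).commutes x).symm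
  haveI : FiniteDimensional K (κ.layer 2) := κ.finiteDimensional_layer_holds 2
  haveI : FiniteDimensional K (κ.layer (2 + 1)) := κ.finiteDimensional_layer_holds (2 + 1)
  haveI : NumberField (κ.layer 2) := NumberField.of_module_finite K _
  haveI : NumberField (κ.layer (2 + 1)) := NumberField.of_module_finite K _
  haveI : IsGalois K (κ.layer 2) := κ.isGalois_layer_holds 2
  haveI : IsGalois K (κ.layer (2 + 1)) := κ.isGalois_layer_holds (2 + 1)
  haveI : IsGalois (κ.layer 2) (κ.layer (2 + 1)) := IsGalois.tower_top_of_isGalois K _ _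
  haveI : FiniteDimensional (κ.layer 2) (κ.layer (2 + 1)) := Module.Finite.of_restrictScalars_finite K _ _
  have hdeg2 : Module.finrank K (κ.layer 2) = 4 := by rw [κ.finrank_layer_holds 2]; norm_num
  have hdeg3 : Module.finrank (κ.layer 2) (κ.layer (2 + 1)) = 2 := finrank_layer_two_layer_three κ
  -- `θ ∈ K₂` (quartic root), `t = √(2+θ) ∈ K₃ ∖ K₂`
  obtain ⟨θ, hθ, t, ht, htK⟩ := exists_quartic_root_layer_two_sqrt_add_layer_three κ hK2 hκ
  have hθit : (fun x : κ.layer 2 => x ^ 2 - 2)^[2] θ = 0 := by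
    rw [iterate_sq_sub_two_two]; linear_combination hθ
  set θO : 𝓞 (κ.layer 2) := ⟨θ, NestedSqrtTwo.isIntegral (R := ℤ) hθit⟩ with hθO
  have hθO4 : θO ^ 4 - 4 * θO ^ 2 + 2 = 0 := by
    apply Subtype.ext
    change ((θO ^ 4 - 4 * θO ^ 2 + 2 : 𝓞 (κ.layer 2)) : κ.layer 2) = ((0 : 𝓞 (κ.layer 2)) : κ.layer 2)
    push_cast
    exact hθ
  set mO : 𝓞 (κ.layer 2) := 2 + θO with hmO
  have hmK : ((mO : 𝓞 (κ.layer 2)) : κ.layer 2) = 2 + θ := by rw [hmO, hθO]; rfl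
  have hmt : t ^ 2 = algebraMap (κ.layer 2) (κ.layer (2 + 1)) (mO : κ.layer 2) := by rw [ht, hmK]
  -- the prime `𝔭₁` and a prime `P` of `K₂` above it
  obtain ⟨h𝔭, h𝔭0, h2𝔭, -⟩ := isPrime_and_mem_of_absNorm_eq_two 𝔭₁ hN
  haveI := h𝔭
  haveI : 𝔭₁.IsMaximal := h𝔭.isMaximal h𝔭0
  obtain ⟨P, hPmax, hPover⟩ := Ideal.exists_maximal_ideal_liesOver_of_isIntegral (S := 𝓞 (κ.layer 2)) 𝔭₁
  haveI := hPmax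
  haveI := hPover
  have hP0 : P ≠ ⊥ := Ideal.ne_bot_of_liesOver_of_ne_bot h𝔭0 P
  have hres := forall_mem_or_sub_one_mem_of_card_quotient_eq_two P
    (card_quotient_eq_two_of_quartic_root hdeg2 hθO4 𝔭₁ hN hunr P)
  obtain ⟨⟨h2P4, h2P5⟩, -, hmP, hmP2⟩ := two_mem_pow_four_and_mem_of_quartic_root hdeg2 hθO4 𝔭₁ h2𝔭 hunr P
  -- the unit `η = A + B θ + C θ² + D θ³` of `𝓞 K₂`
  set f := algebraMap (𝓞 K) (𝓞 (κ.layer 2)) with hf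
  have hq : θO ^ 4 = 4 * θO ^ 2 - 2 := by linear_combination hθO4
  have h0' := congrArg f h0
  have h1' := congrArg f h1
  have h2' := congrArg f h2c
  have h3' := congrArg f h3
  simp only [map_add, map_sub, map_mul, map_ofNat, map_one, map_zero] at h0' h1' h2' h3'
  set η : (𝓞 (κ.layer 2))ˣ := Units.mkOfMulEqOne
    (f A + f B * θO + f C * θO ^ 2 + f D * θO ^ 3) (f A' + f B' * θO + f C' * θO ^ 2 + f D' * θO ^ 3)
    (by
      linear_combination h0' + θO * h1' + θO ^ 2 * h2' + θO ^ 3 * h3' +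
        ((f B * f D' + f C * f C' + f D * f B') + (f C * f D' + f D * f C') * θO + f D * f D' * (θO ^ 2 + 4)) * hq)
    with hη
  obtain ⟨h8, h9⟩ := sub_one_mem_pow_eight_of_baseCert hdeg2 hθO4 𝔭₁ h2𝔭 hunr P hπ₁ hπ₁' hd hγ₀ hA hB hC hD
  have hv8 : (η : 𝓞 (κ.layer 2)) - 1 ∈ P ^ 8 := by rw [hη, Units.val_mkOfMulEqOne]; exact h8
  have hv9 : (η : 𝓞 (κ.layer 2)) - 1 ∉ P ^ 9 := by rw [hη, Units.val_mkOfMulEqOne]; exact h9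
  -- `η ∉ N(K₃ˣ)` and the door at the layer `n = 2`
  have hxE := unitsIncl_unitsMap_mem_unitsE_inf_range (K := κ.layer 2) (L := κ.layer (2 + 1)) η
  have hxN := unitsIncl_unitsMap_not_mem_map_norm_of_sub_one_mem_pow_eight (K := κ.layer 2)
    (L := κ.layer (2 + 1)) hdeg3 hmt htK P hP0 hres h2P4 h2P5 hmP hmP2 η hv8 hv9
  have hs' : {w : HeightOneSpectrum (𝓞 (κ.layer 2)) |
      w.asIdeal.ramificationIdxIn (𝓞 (κ.layer (2 + 1))) ≠ 1}.ncard ≤ 2 :=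
    (ncard_ramified_layer_succ_le κ 2 hram).trans h2
  exact classNumberPExp_eq_of_le_two_of_nonNorm_unit_of_not_dvd κ 2 hram hK (Nat.zero_le 2) hs' hxE hxN hm

/-- ★★ **`μ₂ = 0` (growth form) and `λ₂ = 0` from the layer-two unit certificate** — same hypotheses as
`classNumberPExp_eq_of_le_of_layerTwo_unitCert`: the `2`-class numbers are constant from `K₂` on, so Iwasawa's `μ` and `λ` vanish (`ν = e_2`; the
Iwasawa module `X` is finite).  No class group, prime, unit or element of any layer `K_n`, `n ≥ 1`, is an input: everything is an identity or an ideal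
membership in `𝓞_K`. [cite: Fukuda1994, Thm. 1 (1), p. 264] [cite: Lang1990, Ch. 13 §4, Lemma 4.1–4.2 and sequel (PDF pp. 203–204)]
[cite: Omeara1963, §63B (63:10)] -/
theorem classicalMuVanishes_two_of_layerTwo_unitCert (hκ : κ.IsCyclotomic) (hK2 : ¬ 2 ∣ Module.finrank ℚ K)
    (hram : TotallyRamifiedFrom κ 0) (hK : ¬ 2 ∣ classNumber K)
    (h2 : {v : HeightOneSpectrum (𝓞 K) | ((2 : ℕ) : 𝓞 K) ∈ v.asIdeal}.ncard ≤ 2)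
    (𝔭₁ : Ideal (𝓞 K)) (hN : Ideal.absNorm 𝔭₁ = 2) (hunr : (2 : 𝓞 K) ∉ 𝔭₁ ^ 2)
    {A B C D A' B' C' D' π₁ d γ₀ γ₁ γ₂ γ₃ : 𝓞 K}
    (h0 : A * A' - 2 * (B * D' + C * C' + D * B') - 8 * (D * D') = 1)
    (h1 : A * B' + B * A' - 2 * (C * D' + D * C') = 0)
    (h2c : A * C' + B * B' + C * A' + 4 * (B * D' + C * C' + D * B') + 14 * (D * D') = 0)
    (h3 : A * D' + B * C' + C * B' + D * A' + 4 * (C * D' + D * C') = 0)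
    (hπ₁ : π₁ ∈ 𝔭₁) (hπ₁' : π₁ ∉ 𝔭₁ ^ 2) (hd : d ∉ 𝔭₁) (hγ₀ : γ₀ ∉ 𝔭₁)
    (hA : d * (A - 1) = π₁ ^ 2 * γ₀) (hB : d * B = π₁ ^ 2 * γ₁) (hC : d * C = π₁ ^ 2 * γ₂) (hD : d * D = π₁ ^ 2 * γ₃) :
    ClassicalMuVanishes κ ∧ classicalLambda κ = 0 :=
  ⟨classicalMuVanishes_of_eventually_const κ (c := classNumberPExp κ 2) (n₀ := 2) fun _ hm =>
      classNumberPExp_eq_of_le_of_layerTwo_unitCert κ hκ hK2 hram hK h2 𝔭₁ hN hunr h0 h1 h2c h3 hπ₁ hπ₁' hd hγ₀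
        hA hB hC hD hm,
    classicalLambda_eq_zero_of_eventually_const κ (c := classNumberPExp κ 2) (n₀ := 2) fun _ hm =>
      classNumberPExp_eq_of_le_of_layerTwo_unitCert κ hκ hK2 hram hK h2 𝔭₁ hN hunr h0 h1 h2c h3 hπ₁ hπ₁' hd hγ₀
        hA hB hC hD hm⟩

/-- ★★ **THE DOOR FOR AN ODD-DEGREE FIELD OF ODD DISCRIMINANT** (`2 ∤ d_K`: Fukuda's index is `0` for every cyclotomic `ℤ₂`-extension, tree
`totallyRamifiedFrom_zero_of_not_dvd_discr`, and every dyadic prime is unramified): `2 ∤ h_K`, at most two primes above `2`, `𝔭₁` a prime of norm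
`2`, and the base-field certificate `(A, …, D', π₁, d, γ₀, …, γ₃)` ⟹ `e_m = e_2` for all `m ≥ 2`, for EVERY cyclotomic `ℤ₂`-extension of `K`.
(Cubic `2`-torsion fields `ℚ(β)` with `Δ_W ≡ 5 (mod 8)`: `2 = 𝔭₁𝔭₂`, `𝔭₁` of degree one.) [cite: Fukuda1994, Thm. 1 (1), p. 264]
[cite: Washington1997, §13.3 Prop. 13.22] [cite: NeukirchANT1999, Ch. III (2.12)] -/
theorem classNumberPExp_eq_of_le_of_layerTwo_unitCert_of_not_dvd_discr (hκ : κ.IsCyclotomic)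
    (hK2 : ¬ 2 ∣ Module.finrank ℚ K) (hdK : ¬ (2 : ℤ) ∣ NumberField.discr K) (hK : ¬ 2 ∣ classNumber K)
    (h2 : {v : HeightOneSpectrum (𝓞 K) | ((2 : ℕ) : 𝓞 K) ∈ v.asIdeal}.ncard ≤ 2)
    (𝔭₁ : Ideal (𝓞 K)) (hN : Ideal.absNorm 𝔭₁ = 2)
    {A B C D A' B' C' D' π₁ d γ₀ γ₁ γ₂ γ₃ : 𝓞 K}
    (h0 : A * A' - 2 * (B * D' + C * C' + D * B') - 8 * (D * D') = 1)
    (h1 : A * B' + B * A' - 2 * (C * D' + D * C') = 0)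
    (h2c : A * C' + B * B' + C * A' + 4 * (B * D' + C * C' + D * B') + 14 * (D * D') = 0)
    (h3 : A * D' + B * C' + C * B' + D * A' + 4 * (C * D' + D * C') = 0)
    (hπ₁ : π₁ ∈ 𝔭₁) (hπ₁' : π₁ ∉ 𝔭₁ ^ 2) (hd : d ∉ 𝔭₁) (hγ₀ : γ₀ ∉ 𝔭₁)
    (hA : d * (A - 1) = π₁ ^ 2 * γ₀) (hB : d * B = π₁ ^ 2 * γ₁) (hC : d * C = π₁ ^ 2 * γ₂) (hD : d * D = π₁ ^ 2 * γ₃)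
    {m : ℕ} (hm : 2 ≤ m) :
    classNumberPExp κ m = classNumberPExp κ 2 := by
  obtain ⟨h𝔭, -, h2𝔭, -⟩ := isPrime_and_mem_of_absNorm_eq_two 𝔭₁ hN
  haveI := h𝔭
  exact classNumberPExp_eq_of_le_of_layerTwo_unitCert κ hκ hK2 (totallyRamifiedFrom_zero_of_not_dvd_discr hK2 hdK κ hκ)
    hK h2 𝔭₁ hN (two_not_mem_sq_of_not_dvd_discr hdK 𝔭₁ h2𝔭) h0 h1 h2c h3 hπ₁ hπ₁' hd hγ₀ hA hB hC hD hm

/-- ★★ **`μ₂ = 0` and `λ₂ = 0` for an odd-degree field of odd discriminant from the layer-two unit certificate**, for EVERY cyclotomic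
`ℤ₂`-extension: `2 ∤ [K:ℚ]`, `2 ∤ d_K`, `2 ∤ h_K`, at most two primes above `2`, `N𝔭₁ = 2`, and `(A, …, D', π₁, d, γ₀, …, γ₃)` in `𝓞_K` as above.
The W-free consumer form for the cubic `2`-torsion fields `ℚ(β)` of the cell's `Δ_W ≡ 5 (mod 8)` seeds whose fundamental unit is a local norm from the
second layer at the split prime (`σ₁(ε) ≡ ±1 (mod 16)`), where Chevalley's door and the layer-one unit door are void. [cite: Fukuda1994, Thm. 1 (1), p. 264]
[cite: Lang1990, Ch. 13 §4, Lemma 4.1–4.2 and sequel (PDF pp. 203–204)] [cite: Omeara1963, §63B (63:10)] -/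
theorem classicalMuVanishes_two_of_layerTwo_unitCert_of_not_dvd_discr (hκ : κ.IsCyclotomic)
    (hK2 : ¬ 2 ∣ Module.finrank ℚ K) (hdK : ¬ (2 : ℤ) ∣ NumberField.discr K) (hK : ¬ 2 ∣ classNumber K)
    (h2 : {v : HeightOneSpectrum (𝓞 K) | ((2 : ℕ) : 𝓞 K) ∈ v.asIdeal}.ncard ≤ 2)
    (𝔭₁ : Ideal (𝓞 K)) (hN : Ideal.absNorm 𝔭₁ = 2)
    {A B C D A' B' C' D' π₁ d γ₀ γ₁ γ₂ γ₃ : 𝓞 K}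
    (h0 : A * A' - 2 * (B * D' + C * C' + D * B') - 8 * (D * D') = 1)
    (h1 : A * B' + B * A' - 2 * (C * D' + D * C') = 0)
    (h2c : A * C' + B * B' + C * A' + 4 * (B * D' + C * C' + D * B') + 14 * (D * D') = 0)
    (h3 : A * D' + B * C' + C * B' + D * A' + 4 * (C * D' + D * C') = 0)
    (hπ₁ : π₁ ∈ 𝔭₁) (hπ₁' : π₁ ∉ 𝔭₁ ^ 2) (hd : d ∉ 𝔭₁) (hγ₀ : γ₀ ∉ 𝔭₁)
    (hA : d * (A - 1) = π₁ ^ 2 * γ₀) (hB : d * B = π₁ ^ 2 * γ₁) (hC : d * C = π₁ ^ 2 * γ₂) (hD : d * D = π₁ ^ 2 * γ₃) :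
    ClassicalMuVanishes κ ∧ classicalLambda κ = 0 := by
  obtain ⟨h𝔭, -, h2𝔭, -⟩ := isPrime_and_mem_of_absNorm_eq_two 𝔭₁ hN
  haveI := h𝔭
  exact classicalMuVanishes_two_of_layerTwo_unitCert κ hκ hK2 (totallyRamifiedFrom_zero_of_not_dvd_discr hK2 hdK κ hκ)
    hK h2 𝔭₁ hN (two_not_mem_sq_of_not_dvd_discr hdK 𝔭₁ h2𝔭) h0 h1 h2c h3 hπ₁ hπ₁' hd hγ₀ hA hB hC hD

end Door

end Literature.NumberTheory.IwasawaTheory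

end
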